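import Mathlib.Tactic.Group
import Mathlib.Tactic.NormNum
import Mathlib.Data.Finset.Prod
import Mathlib.GroupTheory.SpecificGroups.Dihedral
import Mathlib.Data.ZMod.Basic
import Literature.Combinatorics.Additive.TPPGroupAlgebra
import Literature.Computability.AlgebraicComplexity.CohnUmansTPP
import HarnessLib

/-!
# ω-census: a single TPP triple beating `Σ dᵢ³` in a group of order 578 (`C₁₇ × D₃₄`, type `⟨18, 8, 8⟩`)

Contributed by the speedrun lane `tpp` (exhaustive TPP-capacity census, summit MatrixMultiplication), seat
`sr-tpp-search-g17` (construction, 2026-08-22) and seat `sr-tpp-search-g18` (tree restyling, 2026-08-22); source file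
`run/shared/lean/speedrun/tpp/sr-tpp-search-g17/lean/Record578.lean` (sha256 `617e13566e1ba610f9f6ad5a5ad0aba06494f0d20b7daf5549cec68afcf011e1`, farm
`lean check` rc 0), restated here over the tree definitions `Literature.Combinatorics.Additive.TripleProductProperty` /
`Literature.Computability.AlgebraicComplexity.RealizesTPP` in the house style of the topic
`Summits/MatrixMultiplication/OmegaCensus` (docstring on every declaration, kernel `decide`, statements unchanged).
Framing: lottery ticket; floor = certified bounds/negative ranges.

## The statement

`G = C₁₇ × D₃₄` (order `578 = 2 · 17²`; `D₃₄ = DihedralGroup 17` in Mathlib's convention `r i * sr j = sr (j - i)`,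
`sr i * sr j = r (j - i)`) contains subsets `S₁, S₂, S₃` of sizes `18, 8, 8` with the triple product property
(Cohn–Umans 2003 Def. 2.1, right-quotient form), i.e. `RealizesTPP G 18 8 8`, and
`18 · 8 · 8 = 1152 > 1122 = D₃(G) := Σ_χ χ(1)³`.

Character-degree bookkeeping (standard; it stays in this docstring because the tree has no character table of `D_{2n}` —
the same convention as `DihedralNoSumOfCubes.lean`): `D₃₄` has `2` linear characters and `8` irreducible characters of
degree `2`, so `Σ d³ (D₃₄) = 2 + 8 · 8 = 66 = 4 · 17 − 2`; character degrees multiply over a direct product with the abelian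
factor `C₁₇` contributing `17` linear characters, so `Σ d³ (C₁₇ × D₃₄) = 17 · 66 = 1122` (equivalently `2|G| − |G/G'| =
1156 − 34`).  The arithmetic comparison is recorded as `sum_cubes_lt_volume`.  CONSEQUENCE (informal here, by
`CKSU2005_thm18.omega_lt_three` once `charDegreePowSum G 3 = 1122` is supplied): this one triple gives `ω < 3` through
Cohn–Kleinberg–Szegedy–Umans 2005 Thm. 1.8 — numerically only `ω ≤ 2.995…` (solve `1152^{w/3} = 17 (2 + 8 · 2^w)`), so
NOTHING here improves a bound on `ω`; the datum is the ORDER: `578` is the smallest order at which the lane knows a group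
beating the sum of the cubes with a single TPP triple (the lane's exhaustive census shows no group of order `< 168` does;
CKSU 2005 §2's worked example and the lane's earlier symmetric-group constructions live at orders `≥ 28 800`).  So the least
such order `N*` satisfies `168 ≤ N* ≤ 578` as of 2026-08-22.

## The sets ("graph construction", lane file RECORD-HUNT.md §3)

With `N = ℤ/17`, `D₂ = {0,1,2,3}`, `D₃ = {4,8,12,16}`, `D₁ = N ∖ (D₂ ∪ D₃)` (`|D₁| = 9`) and `c` a generator of `C₁₇`
(written additively as `Multiplicative (ZMod 17)`):
`S₁ = {c^{-d} r^{d}, c^{-d} r^{d} s : d ∈ D₁}`, `Sᵢ = {c^{d} r^{d}, c^{d} r^{d} s : d ∈ Dᵢ}` (`i = 2, 3`), `s = sr 0`,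
so `r d * s = sr (-d)`.  Why it works (the lane's "level lemma", RECORD-HUNT.md §2–3): for sets of this shape the TPP
condition reduces to `D₁, D₂, D₃` pairwise disjoint and all sums `d₂ + d₃` (`d₂ ∈ D₂`, `d₃ ∈ D₃`) distinct — here
`D₂ + D₃ = ℤ/17 ∖ {3}`, 16 distinct sums; the kernel does not use this — it checks the quotient-set criterion
`tpp_of_quot` by `decide`.

What is deliberately NOT here: the value `charDegreePowSum (C₁₇ × D₃₄) 3 = 1122` as a Lean theorem (needs the character
table of `D₃₄`); the lane's second example `C₂₁ × D₄₂` (order 882, type `⟨24, 12, 6⟩`, `1728 > 1722`; lane data, not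
kernel-checked); any claim of minimality of `578`.

References: Cohn–Umans 2003, Def. 2.1, Thm. 4.1 [CohnUmans2003]; Cohn–Kleinberg–Szegedy–Umans 2005, Def. 1.3, Thm. 1.8, §2
[CohnKleinbergSzegedyUmans2005].
-/

namespace Summit.MatrixMultiplication.OmegaCensus.Cyclic17Dihedral34Record

open Finset DihedralGroup
open Literature.Combinatorics.Additive
open Literature.Computability.AlgebraicComplexity

section Criterion
variable {H : Type*} [Group H] [DecidableEq H]

/-- Right quotient set `Q(S) = {x y⁻¹ : x, y ∈ S}` of a finite subset of a group. [folklore] -/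
def quot (S : Finset H) : Finset H := (S ×ˢ S).image fun p => p.1 * p.2⁻¹

/-- `x y⁻¹ ∈ Q(S)` for `x, y ∈ S`. [folklore] -/
theorem mem_quot {S : Finset H} {x y : H} (hx : x ∈ S) (hy : y ∈ S) : x * y⁻¹ ∈ quot S :=
  Finset.mem_image.2 ⟨(x, y), Finset.mk_mem_product hx hy, rfl⟩

/-- **Quotient-set criterion for the triple product property**: if `q₁ ∈ Q(S)`, `q₂ ∈ Q(T)`, `(q₁q₂)⁻¹ ∈ Q(U)`
forces `q₁ = q₂ = 1`, then `(S, T, U)` has the TPP (Cohn–Umans 2003, remark after Def. 2.1: the TPP is a statement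
about the quotient sets). [folklore] -/
theorem tpp_of_quot (S T U : Finset H)
    (h : ∀ q₁ ∈ quot S, ∀ q₂ ∈ quot T, (q₁ * q₂)⁻¹ ∈ quot U → q₁ = 1 ∧ q₂ = 1) :
    TripleProductProperty S T U := by
  intro s hs s' hs' t ht t' ht' u hu u' hu' he
  have h3 : (s * s'⁻¹ * (t * t'⁻¹))⁻¹ = u * u'⁻¹ :=
    inv_eq_of_mul_eq_one_right he
  obtain ⟨e1, e2⟩ := h _ (mem_quot hs hs') _ (mem_quot ht ht') (h3 ▸ mem_quot hu hu')
  refine ⟨mul_inv_eq_one.mp e1, mul_inv_eq_one.mp e2, ?_⟩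
  rw [e1, e2, one_mul, one_mul] at he
  exact mul_inv_eq_one.mp he

end Criterion

/-- The ambient group `G = C₁₇ × D₃₄ = Multiplicative (ZMod 17) × DihedralGroup 17`. -/
abbrev G := Multiplicative (ZMod 17) × DihedralGroup 17

/-- `|C₁₇ × D₃₄| = 578`. [folklore] -/
theorem card_G : Fintype.card G = 578 := by
  simp [G, Fintype.card_prod, ZMod.card, DihedralGroup.card]

/-- Level support of `S₁`: `D₁ = ℤ/17 ∖ ({0,1,2,3} ∪ {4,8,12,16})`. -/
def D1 : Finset (ZMod 17) := {5, 6, 7, 9, 10, 11, 13, 14, 15}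
/-- Level support of `S₂`: `D₂ = {0,1,2,3}`. -/
def D2 : Finset (ZMod 17) := {0, 1, 2, 3}
/-- Level support of `S₃`: `D₃ = {4,8,12,16} = 4 · D₂`; `D₂ ⊕ D₃` is direct in `ℤ/17`. -/
def D3 : Finset (ZMod 17) := {4, 8, 12, 16}

/-- The two-element block `{c^{ε d} r^{d}, c^{ε d} r^{d} s}` at level `d` (`s = sr 0`, so `r d * s = sr (-d)`). -/
def cell (ε d : ZMod 17) : Finset G :=
  {(Multiplicative.ofAdd (ε * d), r d), (Multiplicative.ofAdd (ε * d), sr (-d))}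

/-- `S₁ = ⋃_{d ∈ D₁} {c^{-d} r^d, c^{-d} r^d s}` (18 elements). -/
def S1 : Finset G := D1.biUnion (cell (-1))
/-- `S₂ = ⋃_{d ∈ D₂} {c^{d} r^d, c^{d} r^d s}` (8 elements). -/
def S2 : Finset G := D2.biUnion (cell 1)
/-- `S₃ = ⋃_{d ∈ D₃} {c^{d} r^d, c^{d} r^d s}` (8 elements). -/
def S3 : Finset G := D3.biUnion (cell 1)

/-- The sizes: `|S₁| = 18`, `|S₂| = 8`, `|S₃| = 8` (kernel `decide`). -/
theorem card_S : S1.card = 18 ∧ S2.card = 8 ∧ S3.card = 8 := by decide +kernel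

/-- The quotient-set criterion holds for `(S₁, S₂, S₃)` (kernel `decide` over `Q(S₁) × Q(S₂)`). -/
theorem quot_criterion :
    ∀ q₁ ∈ quot S1, ∀ q₂ ∈ quot S2, (q₁ * q₂)⁻¹ ∈ quot S3 → q₁ = 1 ∧ q₂ = 1 := by
  decide +kernel

/-- **The triple `(S₁, S₂, S₃)` of `C₁₇ × D₃₄` has the triple product property.** (speedrun lane `tpp`, 2026-08-22) -/
theorem tpp : TripleProductProperty S1 S2 S3 := tpp_of_quot _ _ _ quot_criterion

/-- **`C₁₇ × D₃₄` realizes `⟨18, 8, 8⟩`** (tree `RealizesTPP`; volume `1152`). (speedrun lane `tpp`, 2026-08-22) -/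
theorem realizesTPP_18_8_8 : RealizesTPP G 18 8 8 :=
  ⟨S1, S2, S3, card_S.1, card_S.2.1, card_S.2.2, tpp⟩

/-- The volume beats the sum of the cubes of the character degrees: `D₃(C₁₇ × D₃₄) = 17 · (4 · 17 − 2) = 1122 < 1152 =
18 · 8 · 8` (the identification `Σ d³ = 17 · (4 · 17 − 2)` is the docstring bookkeeping above, not a Lean fact here). [folklore] -/
theorem sum_cubes_lt_volume : 17 * (4 * 17 - 2) < 18 * 8 * 8 := by norm_num

/-- The same comparison against `2|G| − 34` (`= Σ d³` for a group of order 578 with 34 linear characters and all other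
degrees equal to 2): `2 · 578 − 34 < 1152`. [folklore] -/
theorem two_card_sub_lt_volume : 2 * Fintype.card G - 34 < 18 * 8 * 8 := by
  rw [card_G]; norm_num

end Summit.MatrixMultiplication.OmegaCensus.Cyclic17Dihedral34Record
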